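import Mathlib

/-!
# Tier 3 (T3.2) — finite `ℤ_p`-modules are `p`-groups; a quotient of order prime to `p` is trivial

Kernel twin of the GROUP-THEORETIC content of proofs/t3-p3/R2-PINNING-ADDENDUM-4.md §A21 (2) / (2′) /
(3) — «Γ⁻_𝔭 ≅ ℤ_p × T_𝔭 with T_𝔭 a finite p-group … T_𝔭 = 1 and Γ⁻_𝔭 ≅ ℤ_p whenever p ∤ |Cl| …
«p ∤ h⁻_{E′}» already forces T_𝔭 = 1». The groups `Γ⁻ ≅ ℤ_p^d ⊇ Γ₀ ⊇ H` of the chain are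
`ℤ_p`-modules, and on the kernel:

* a torsion element of a `ℤ_p`-module is killed by a POWER OF `p` (`PadicInt.unitCoeff_spec`:
  `r = u · p^{v_p(r)}` with `u` a unit) — `pow_smul_eq_zero_of_smul_eq_zero`,
  `exists_pow_nsmul_eq_zero_of_mem_torsion`; so the torsion submodule (the chain's `T_𝔭`) is a
  `p`-group (`isPGroup_multiplicative_torsion`);
* every element of a FINITE `ℤ_p`-module has `p`-power order: the module is a `p`-group
  (`isPGroup_multiplicative`) of cardinality a power of `p` (`exists_nat_card_eq_pow`), and of
  cardinality prime to `p` it is trivial (`subsingleton_of_not_dvd_card`);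
* a finite quotient `M ⧸ N` is therefore a `p`-group (`exists_nat_card_quotient_eq_pow`), and
  `N = ⊤` as soon as `Nat.card (M ⧸ N)` is prime to `p` (`eq_top_of_not_dvd_card`) — in particular
  when `M ⧸ N` is the image of a finite group of order prime to `p`
  (`eq_top_of_surjective_of_not_dvd_card`, additive and multiplicative forms): the
  class-field-theory sentence «Γ⁻/Γ₀ is a quotient of the minus `p`-class group» enters ONLY as
  that surjection and stays on the page;
* the line: `(ι → ℤ_p) ⧸ ker (proj i₀) ≃ₗ ℤ_p` (`quotKerProjEquiv`: `Γ₀/H = ℤ_p e_𝔭`), and the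
  composite `§A21 (2′)`: `Γ⁻ ⊇ Γ₀ ⊇ H`, `Γ⁻/Γ₀` the image of a finite group of order prime to `p`,
  `Γ₀/H ≃ ℤ_p` ⇒ `Γ⁻/H ≃ ℤ_p` (`quotientEquivOfEqTop`,
  `nonempty_linearEquiv_quotient_of_surjective_of_not_dvd_card`).

Imports: Mathlib only; no instance, no notation; no axiom beyond the standard three.
-/

namespace Summit.Ventures.HodgeRepro.T3.PadicFiniteQuotient

variable {p : ℕ} [hp : Fact p.Prime]

section Torsion

variable {M : Type*} [AddCommGroup M] [Module ℤ_[p] M]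

/-- If `r ≠ 0` kills `x`, so does `p ^ v_p(r)`: write `r = u · p^{v_p(r)}` with `u ∈ ℤ_pˣ`
(`PadicInt.unitCoeff_spec`). -/
theorem pow_smul_eq_zero_of_smul_eq_zero {r : ℤ_[p]} (hr : r ≠ 0) {x : M} (h : r • x = 0) :
    (p : ℤ_[p]) ^ r.valuation • x = 0 := by
  have hspec : r = (PadicInt.unitCoeff hr : ℤ_[p]) * (p : ℤ_[p]) ^ r.valuation :=
    PadicInt.unitCoeff_spec hr
  calc (p : ℤ_[p]) ^ r.valuation • x
      = (((PadicInt.unitCoeff hr)⁻¹ : ℤ_[p]ˣ) : ℤ_[p]) •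
          (((PadicInt.unitCoeff hr : ℤ_[p]) * (p : ℤ_[p]) ^ r.valuation) • x) := by
        rw [smul_smul, ← mul_assoc, Units.inv_mul, one_mul]
    _ = (((PadicInt.unitCoeff hr)⁻¹ : ℤ_[p]ˣ) : ℤ_[p]) • (r • x) := by rw [← hspec]
    _ = 0 := by rw [h, smul_zero]

/-- A torsion element of a `ℤ_p`-module is killed by some `p ^ k` (as a scalar of `ℤ_p`). -/
theorem exists_pow_smul_eq_zero_of_mem_torsion {x : M} (hx : x ∈ Submodule.torsion ℤ_[p] M) :
    ∃ k : ℕ, (p : ℤ_[p]) ^ k • x = 0 := by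
  obtain ⟨a, ha⟩ := (Submodule.mem_torsion_iff x).mp hx
  exact ⟨(a : ℤ_[p]).valuation,
    pow_smul_eq_zero_of_smul_eq_zero (nonZeroDivisors.coe_ne_zero a) ha⟩

/-- A torsion element of a `ℤ_p`-module is killed by some natural number `p ^ k`
(the `ℕ`-action): it has `p`-power additive order. -/
theorem exists_pow_nsmul_eq_zero_of_mem_torsion {x : M} (hx : x ∈ Submodule.torsion ℤ_[p] M) :
    ∃ k : ℕ, p ^ k • x = 0 := by
  obtain ⟨k, hk⟩ := exists_pow_smul_eq_zero_of_mem_torsion hx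
  refine ⟨k, ?_⟩
  rw [← Nat.cast_smul_eq_nsmul ℤ_[p], Nat.cast_pow]
  exact hk

/-- An element of finite additive order in a `ℤ_p`-module is torsion (`ℤ_p` has
characteristic `0`, so its additive order is a non-zero scalar). -/
theorem mem_torsion_of_isOfFinAddOrder {x : M} (hx : IsOfFinAddOrder x) :
    x ∈ Submodule.torsion ℤ_[p] M := by
  rw [Submodule.mem_torsion_iff]
  refine ⟨⟨(addOrderOf x : ℤ_[p]), mem_nonZeroDivisors_of_ne_zero ?_⟩, ?_⟩
  · exact_mod_cast hx.addOrderOf_pos.ne'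
  · show ((addOrderOf x : ℕ) : ℤ_[p]) • x = 0
    rw [Nat.cast_smul_eq_nsmul, addOrderOf_nsmul_eq_zero]

/-- In a finite `ℤ_p`-module every element is killed by a power of `p`. -/
theorem exists_pow_nsmul_eq_zero [Finite M] (x : M) : ∃ k : ℕ, p ^ k • x = 0 :=
  exists_pow_nsmul_eq_zero_of_mem_torsion
    (mem_torsion_of_isOfFinAddOrder (isOfFinAddOrder_of_finite x))

/-- The torsion submodule of a `ℤ_p`-module is a `p`-group (written multiplicatively): the
chain's `T_𝔭` is a `p`-group. -/
theorem isPGroup_multiplicative_torsion :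
    IsPGroup p (Multiplicative (Submodule.torsion ℤ_[p] M)) := fun g => by
  obtain ⟨k, hk⟩ := exists_pow_nsmul_eq_zero_of_mem_torsion (p := p) (Multiplicative.toAdd g).2
  refine ⟨k, ?_⟩
  rw [← ofAdd_toAdd g, ← ofAdd_nsmul, ofAdd_eq_one]
  exact Subtype.ext (by simpa using hk)

/-- A finite `ℤ_p`-module is a `p`-group (written multiplicatively). -/
theorem isPGroup_multiplicative [Finite M] : IsPGroup p (Multiplicative M) := fun g => by
  obtain ⟨k, hk⟩ := exists_pow_nsmul_eq_zero (p := p) (Multiplicative.toAdd g)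
  exact ⟨k, by rw [← ofAdd_toAdd g, ← ofAdd_nsmul, hk, ofAdd_zero]⟩

/-- The cardinality of a finite `ℤ_p`-module is a power of `p`. -/
theorem exists_nat_card_eq_pow [Finite M] : ∃ k : ℕ, Nat.card M = p ^ k := by
  obtain ⟨k, hk⟩ := IsPGroup.iff_card.mp (isPGroup_multiplicative (p := p) (M := M))
  exact ⟨k, (Nat.card_congr Multiplicative.toAdd).symm.trans hk⟩

/-- A finite `ℤ_p`-module of cardinality prime to `p` is trivial. -/
theorem subsingleton_of_not_dvd_card [Finite M] (h : ¬ p ∣ Nat.card M) : Subsingleton M := by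
  obtain ⟨k, hk⟩ := exists_nat_card_eq_pow (p := p) (M := M)
  have hk0 : k = 0 := by
    rcases k with _ | k
    · rfl
    · exact absurd (hk ▸ dvd_pow_self p (Nat.succ_ne_zero k)) h
  rw [hk0, pow_zero] at hk
  exact (Nat.card_eq_one_iff_unique.mp hk).1

/-- The cardinality of a finite torsion submodule is a power of `p`: `T_𝔭` is a finite
`p`-group. -/
theorem exists_nat_card_torsion_eq_pow [Finite (Submodule.torsion ℤ_[p] M)] :
    ∃ k : ℕ, Nat.card (Submodule.torsion ℤ_[p] M) = p ^ k :=
  exists_nat_card_eq_pow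

end Torsion

section Quotient

variable {M : Type*} [AddCommGroup M] [Module ℤ_[p] M] (N : Submodule ℤ_[p] M)

/-- A finite quotient of a `ℤ_p`-module is a `p`-group. -/
theorem isPGroup_multiplicative_quotient [Finite (M ⧸ N)] :
    IsPGroup p (Multiplicative (M ⧸ N)) :=
  isPGroup_multiplicative

/-- A finite quotient of a `ℤ_p`-module has cardinality a power of `p`. -/
theorem exists_nat_card_quotient_eq_pow [Finite (M ⧸ N)] :
    ∃ k : ℕ, Nat.card (M ⧸ N) = p ^ k :=
  exists_nat_card_eq_pow

/-- `N = ⊤` as soon as the finite quotient `M ⧸ N` has cardinality prime to `p`. -/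
theorem eq_top_of_not_dvd_card [Finite (M ⧸ N)] (h : ¬ p ∣ Nat.card (M ⧸ N)) : N = ⊤ :=
  Submodule.Quotient.subsingleton_iff.mp (subsingleton_of_not_dvd_card (p := p) h)

/-- The chain's composite, additive form: if `M ⧸ N` is the image of a FINITE additive group of
order prime to `p` (§A21 (2′): «Γ⁻/Γ₀ is a quotient of `Cl⁻_{E′}[p^∞]`» with `p ∤ h⁻_{E′}`), then
`N = ⊤`. -/
theorem eq_top_of_surjective_of_not_dvd_card {C : Type*} [AddGroup C] [Finite C]
    (f : C →+ M ⧸ N) (hf : Function.Surjective f) (h : ¬ p ∣ Nat.card C) : N = ⊤ := by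
  haveI : Finite (M ⧸ N) := Finite.of_surjective f hf
  refine eq_top_of_not_dvd_card N fun hdvd => h (dvd_trans hdvd ?_)
  rw [← Nat.card_congr (QuotientAddGroup.quotientKerEquivOfSurjective f hf).toEquiv]
  exact AddSubgroup.card_quotient_dvd_card _

/-- The same with the finite group written multiplicatively (a class group is a multiplicative
group): a surjection `C →* Multiplicative (M ⧸ N)` from a finite group of order prime to `p`
forces `N = ⊤`. -/
theorem eq_top_of_surjective_of_not_dvd_card' {C : Type*} [Group C] [Finite C]
    (f : C →* Multiplicative (M ⧸ N)) (hf : Function.Surjective f) (h : ¬ p ∣ Nat.card C) :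
    N = ⊤ := by
  haveI : Finite (M ⧸ N) := Finite.of_surjective (Multiplicative.toAdd ∘ f)
    (Multiplicative.toAdd.surjective.comp hf)
  refine eq_top_of_not_dvd_card N fun hdvd => h (dvd_trans hdvd ?_)
  rw [← Nat.card_congr Multiplicative.toAdd,
    ← Nat.card_congr (QuotientGroup.quotientKerEquivOfSurjective f hf).toEquiv]
  exact Subgroup.card_quotient_dvd_card _

/-- If `N = ⊤`, the quotient `M ⧸ K` is the quotient of `N` by `K ∩ N` computed inside `N`
(the chain's «`Γ⁻/H = Γ₀/H` once `Γ⁻ = Γ₀`»). -/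
noncomputable def quotientEquivOfEqTop {K : Submodule ℤ_[p] M} (hN : N = ⊤) :
    (N ⧸ K.comap N.subtype) ≃ₗ[ℤ_[p]] (M ⧸ K) :=
  (Submodule.quotEquivOfEq _ _ (by rw [LinearMap.ker_comp, Submodule.ker_mkQ])).trans
    (LinearMap.quotKerEquivOfSurjective (K.mkQ ∘ₗ N.subtype) (by
      intro y
      induction y using Submodule.Quotient.induction_on with
      | H x => exact ⟨⟨x, hN ▸ Submodule.mem_top⟩, rfl⟩))

end Quotient

section Line

variable {ι : Type*}

/-- The quotient of `ι → ℤ_p` (= `ℤ_p^d`) by the kernel of the `i₀`-th coordinate projection is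
`ℤ_p`: `Γ₀ / H = ℤ_p e_𝔭` for `Γ₀ = ⊕_𝔮 ℤ_p e_𝔮`, `H = ⊕_{𝔮 ≠ 𝔭} ℤ_p e_𝔮`. -/
noncomputable def quotKerProjEquiv (i₀ : ι) :
    ((ι → ℤ_[p]) ⧸ LinearMap.ker (LinearMap.proj i₀ : (ι → ℤ_[p]) →ₗ[ℤ_[p]] ℤ_[p]))
      ≃ₗ[ℤ_[p]] ℤ_[p] :=
  LinearMap.quotKerEquivOfSurjective _ (LinearMap.proj_surjective i₀)

/-- §A21 (2′) on the kernel: `M ⊇ N ⊇ K` (`Γ⁻ ⊇ Γ₀ ⊇ H`) `ℤ_p`-modules, `M ⧸ N` the image of a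
finite additive group of order prime to `p`, and `N ⧸ (K ∩ N) ≃ ℤ_p` — then `M ⧸ K ≃ ℤ_p`
(`Γ⁻_𝔭 = Γ⁻/H ≅ ℤ_p` under `p ∤ h⁻_{E′}`). -/
theorem nonempty_linearEquiv_quotient_of_surjective_of_not_dvd_card
    {M : Type*} [AddCommGroup M] [Module ℤ_[p] M] {K N : Submodule ℤ_[p] M}
    {C : Type*} [AddGroup C] [Finite C] (f : C →+ M ⧸ N) (hf : Function.Surjective f)
    (h : ¬ p ∣ Nat.card C) (e : (N ⧸ K.comap N.subtype) ≃ₗ[ℤ_[p]] ℤ_[p]) :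
    Nonempty ((M ⧸ K) ≃ₗ[ℤ_[p]] ℤ_[p]) :=
  ⟨(quotientEquivOfEqTop N (eq_top_of_surjective_of_not_dvd_card N f hf h)).symm.trans e⟩

/-- The same with the finite group multiplicative. -/
theorem nonempty_linearEquiv_quotient_of_surjective_of_not_dvd_card'
    {M : Type*} [AddCommGroup M] [Module ℤ_[p] M] {K N : Submodule ℤ_[p] M}
    {C : Type*} [Group C] [Finite C] (f : C →* Multiplicative (M ⧸ N))
    (hf : Function.Surjective f) (h : ¬ p ∣ Nat.card C)
    (e : (N ⧸ K.comap N.subtype) ≃ₗ[ℤ_[p]] ℤ_[p]) :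
    Nonempty ((M ⧸ K) ≃ₗ[ℤ_[p]] ℤ_[p]) :=
  ⟨(quotientEquivOfEqTop N (eq_top_of_surjective_of_not_dvd_card' N f hf h)).symm.trans e⟩

end Line

end Summit.Ventures.HodgeRepro.T3.PadicFiniteQuotient
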